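import Summits.Ventures.PercRepro.Defs

/-!
# Uniform percolation: probabilities as polynomials in one parameter

With every edge open with the same probability `q` (`p = fun _ => q`), the probability of an
event `A` is the polynomial
`P_q(A) = ∑_{j=0}^{m} N_A(j) · q^j · (1 - q)^{m-j}`, `m = |E|`,
where `N_A(j) = #{ω ∈ A | ω has exactly j open edges}` (`countOpen A j`).  This is the form in
which the enumeration engine reports its symbolic-in-`p` counts, and the form on which
Bernstein-coefficient certificates of polynomial inequalities act.

* `prob_const_eq_sum_pow`: `P_q(A) = ∑_ω 1_A(ω) q^{#open ω} (1 - q)^{m - #open ω}`;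
* `prob_const_eq_sum_countOpen`: the count form above;
* `countOpen_univ_eq_choose`: `N_Ω(j) = C(m, j)`, and the binomial identity
  `∑_j C(m, j) q^j (1 - q)^{m-j} = 1` as `sum_choose_mul_pow_mul_pow`.
-/

open Finset

namespace PercRepro

variable {E : Type*} [Fintype E] [DecidableEq E]

/-- Uniform percolation: `P_q(A) = ∑_ω 1_A(ω) · q^{#open ω} · (1 - q)^{|E| - #open ω}`. -/
theorem prob_const_eq_sum_pow (q : ℝ) (A : Set (Config E)) :
    prob (fun _ => q) A =
      ∑ ω, A.indicator (fun ω => q ^ (openEdges ω).card *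
        (1 - q) ^ (Fintype.card E - (openEdges ω).card)) ω := by
  unfold prob
  refine Finset.sum_congr rfl fun ω _ => ?_
  by_cases hA : ω ∈ A
  · rw [Set.indicator_of_mem hA, Set.indicator_of_mem hA, weight_const]
  · rw [Set.indicator_of_notMem hA, Set.indicator_of_notMem hA]

/-- `countOpen A j = N_A(j)`: the number of configurations in `A` with exactly `j` open edges. -/
def countOpen (A : Set (Config E)) [DecidablePred (· ∈ A)] (j : ℕ) : ℕ :=
  (univ.filter fun ω : Config E => ω ∈ A ∧ (openEdges ω).card = j).card

omit [DecidableEq E] in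
/-- The number of open edges is at most `|E|`. -/
theorem card_openEdges_le (ω : Config E) : (openEdges ω).card ≤ Fintype.card E :=
  Finset.card_le_univ _

/-- `N_A(j) = 0` for `j > |E|`. -/
theorem countOpen_eq_zero_of_lt (A : Set (Config E)) [DecidablePred (· ∈ A)] {j : ℕ}
    (hj : Fintype.card E < j) : countOpen A j = 0 := by
  unfold countOpen
  rw [Finset.card_eq_zero, Finset.filter_eq_empty_iff]
  intro ω _ h
  exact absurd (h.2 ▸ card_openEdges_le ω) (not_le.2 hj)

/-- **Uniform percolation as a polynomial in `q`** (the engine's symbolic counts):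
`P_q(A) = ∑_{j=0}^{|E|} N_A(j) · q^j · (1 - q)^{|E| - j}`. -/
theorem prob_const_eq_sum_countOpen (q : ℝ) (A : Set (Config E)) [DecidablePred (· ∈ A)] :
    prob (fun _ => q) A =
      ∑ j ∈ range (Fintype.card E + 1),
        (countOpen A j : ℝ) * (q ^ j * (1 - q) ^ (Fintype.card E - j)) := by
  rw [prob_const_eq_sum_pow]
  have hsplit : ∀ ω : Config E, A.indicator (fun ω => q ^ (openEdges ω).card *
      (1 - q) ^ (Fintype.card E - (openEdges ω).card)) ω =
      ∑ j ∈ range (Fintype.card E + 1),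
        if ω ∈ A ∧ (openEdges ω).card = j then q ^ j * (1 - q) ^ (Fintype.card E - j) else 0 := by
    intro ω
    by_cases hA : ω ∈ A
    · rw [Set.indicator_of_mem hA, Finset.sum_eq_single (openEdges ω).card]
      · simp [hA]
      · intro j _ hj
        simp [hj.symm]
      · intro h
        exact absurd (Finset.mem_range.2 (Nat.lt_succ_of_le (card_openEdges_le ω))) h
    · rw [Set.indicator_of_notMem hA]
      symm
      exact Finset.sum_eq_zero fun j _ => by simp [hA]
  simp only [hsplit]
  rw [Finset.sum_comm]
  refine Finset.sum_congr rfl fun j _ => ?_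
  rw [← Finset.sum_filter, Finset.sum_const, nsmul_eq_mul]
  rfl

/-- `N_Ω(j) = C(|E|, j)`: the number of configurations with exactly `j` open edges. -/
theorem countOpen_univ_eq_choose (j : ℕ) :
    countOpen (Set.univ : Set (Config E)) j = (Fintype.card E).choose j := by
  unfold countOpen
  simp only [Set.mem_univ, true_and]
  rw [← Finset.card_univ, ← Finset.card_powersetCard j (univ : Finset E)]
  rw [Finset.card_bij (fun ω _ => openEdges ω)]
  · intro ω hω
    simp only [Finset.mem_filter, Finset.mem_univ, true_and] at hω
    simp [Finset.mem_powersetCard, hω]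
  · intro ω₁ _ ω₂ _ h
    funext e
    have := congrArg (fun S : Finset E => e ∈ S) h
    simpa [mem_openEdges] using this
  · intro S hS
    refine ⟨fun e => decide (e ∈ S), ?_, ?_⟩
    · simp only [Finset.mem_filter, Finset.mem_univ, true_and]
      rw [Finset.mem_powersetCard] at hS
      rw [← hS.2]
      congr 1
      ext e
      simp
    · ext e
      simp

/-- The binomial identity `∑_j C(m, j) q^j (1 - q)^{m-j} = 1`, as the total mass of uniform
percolation. -/
theorem sum_choose_mul_pow_mul_pow (q : ℝ) :
    ∑ j ∈ range (Fintype.card E + 1),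
      ((Fintype.card E).choose j : ℝ) * (q ^ j * (1 - q) ^ (Fintype.card E - j)) = 1 := by
  have h := prob_const_eq_sum_countOpen (E := E) q Set.univ
  rw [prob_univ] at h
  simp only [countOpen_univ_eq_choose] at h
  exact h.symm

end PercRepro
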